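import Mathlib
import HarnessLib
import Summits.NavierStokesRegularity.NavierStokesRegularity.Theorems.IsobarTomographyTubeAlternativeStubDefectAnalyticOfVelocity

/-!
# Rigid-motion kinematics: stub K0 of the line `killing_door` (crux K2 `PoloidalWindowRigidity`)

Seat cstrat-stmt-NavierStokesRegularity-19708-g7 (crux-strategist; `--supports stmt-NavierStokesRegularity-19708`).
The registered stub `stub_rigidMotionKinematics` of `Cruxes/PoloidalWindowRigidity/Lines/killing_door.lean`, BY NAME and
signature: a field `v : ℝ → ℝ³ → ℝ³`, real-analytic on the backward slab `(−∞,0) × ℝ³`, which on some nonempty open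
space–time set is a RELATIVE EQUILIBRIUM — `∂ₜv + Dv·(c + Sx) − Sv = 0` for a constant vector `c` and a constant skew operator
`S` — has two slices `s < t < 0` congruent by a Euclidean motion (the hypothesis of the congruence door
`…CongruenceDoor.stub_congruenceDoor`).  Pure calculus, no Navier–Stokes:

1. the defect `z ↦ D(uncurry v)(z)(1,0) + D(uncurry v)(z)(0, c + S z₂) − S v(z)` is analytic on the (preconnected, open)
   slab and vanishes on the open set, hence on the slab (identity theorem);
2. `R τ = exp(τS)` solves `R′ = S R`, is norm-preserving because `S` is skew (`d/dτ ‖R τ x‖² = 2⟪R τ x, S R τ x⟫ = 0`), hence a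
   linear isometry equivalence of the finite-dimensional space; the translation part `β(τ) = ∫₀^τ R σ c dσ` satisfies
   `S β(τ) + c = R τ c` (fundamental theorem of calculus), so the screw motion `g_τ x = R τ x + β τ` has velocity
   `c + S g_τ x`;
3. along `g`, the curve `τ ↦ v(τ, g_{τ+2} x)` solves the linear ODE `y′ = S y` on `[−2, −1]` (chain rule + step 1), as does
   `τ ↦ R(τ+2) v(−2, x)`; by uniqueness (`ODE_solution_unique_of_mem_Icc_right`) `v(−1, g₁ x) = R 1 · v(−2, x)`, i.e.
   `v(−1, y) = A v(−2, A⁻¹(y − b))` for all `y`, with `A = R 1`, `b = β 1`.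

WHAT THIS IS NOT: not a statement about Navier–Stokes regularity; it closes one TRUE kinematic stub of one line of one crux.
-/

noncomputable section

-- the summit and its single sub-problem share the name (CONVENTIONS §1)
set_option linter.dupNamespace false

namespace Summit.NavierStokesRegularity.NavierStokesRegularity.Theorems.PoloidalWindowDoorPoloidalWindowRigidityKillingKinematics

open Set Function Filter Topology
open scoped RealInnerProductSpace InnerProductSpace
open Literature.Analysis.FluidPDE
open Summit.NavierStokesRegularity.NavierStokesRegularity.Theorems.TubeAlternative.AnalyticPropagation

/-! ### 1. The one-parameter group of a (skew) operator and the screw motion it generates -/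

section Group

set_option linter.unusedSectionVars false

variable {E : Type*} [NormedAddCommGroup E] [InnerProductSpace ℝ E] [CompleteSpace E]

/-- `rot S τ = exp(τ S)`. [folklore] -/
def rot (S : E →L[ℝ] E) (τ : ℝ) : E →L[ℝ] E := NormedSpace.exp (τ • S)

theorem rot_zero (S : E →L[ℝ] E) : rot S 0 = 1 := by
  simp [rot]

/-- `d/dτ exp(τS) = S exp(τS)` (Mathlib `hasDerivAt_exp_smul_const'`). [folklore] -/
theorem hasDerivAt_rot (S : E →L[ℝ] E) (τ : ℝ) : HasDerivAt (fun u => rot S u) (S * rot S τ) τ := by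
  unfold rot
  exact hasDerivAt_exp_smul_const' (𝕂 := ℝ) S τ

/-- Orbits: `d/dτ (exp(τS) x) = S (exp(τS) x)`. [folklore] -/
theorem hasDerivAt_rot_apply (S : E →L[ℝ] E) (x : E) (τ : ℝ) :
    HasDerivAt (fun u => rot S u x) (S (rot S τ x)) τ := by
  have h := (hasDerivAt_rot S τ).clm_apply (hasDerivAt_const τ x)
  simpa using h

theorem continuous_rot_apply (S : E →L[ℝ] E) (x : E) : Continuous fun u => rot S u x :=
  continuous_iff_continuousAt.2 fun u => (hasDerivAt_rot_apply S x u).continuousAt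

/-- For a skew operator, `exp(τS)` preserves the norm. [folklore] -/
theorem norm_rot (S : E →L[ℝ] E) (hS : ∀ x y : E, ⟪S x, y⟫_ℝ = -⟪x, S y⟫_ℝ) (τ : ℝ) (x : E) :
    ‖rot S τ x‖ = ‖x‖ := by
  have h0 : ∀ w : E, ⟪w, S w⟫_ℝ = 0 := by
    intro w
    have h := hS w w
    rw [real_inner_comm w (S w)] at h
    linarith
  have hd : ∀ u : ℝ, HasDerivAt (fun u => ‖rot S u x‖ ^ 2) 0 u := by
    intro u
    have h := (hasDerivAt_rot_apply S x u).norm_sq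
    simpa [h0] using h
  have hconst := is_const_of_deriv_eq_zero (fun u => (hd u).differentiableAt) (fun u => (hd u).deriv) τ 0
  simp only [rot_zero, one_apply_eq_self] at hconst
  exact (pow_left_inj₀ (norm_nonneg _) (norm_nonneg _) two_ne_zero).1 hconst

/-- `exp(τS)` as a linear isometry equivalence (finite dimension: an isometry onto). [folklore] -/
def rotIso [FiniteDimensional ℝ E] (S : E →L[ℝ] E) (hS : ∀ x y : E, ⟪S x, y⟫_ℝ = -⟪x, S y⟫_ℝ) (τ : ℝ) :
    E ≃ₗᵢ[ℝ] E :=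
  LinearIsometry.toLinearIsometryEquiv
    ({ toLinearMap := (rot S τ : E →L[ℝ] E).toLinearMap, norm_map' := norm_rot S hS τ } : E →ₗᵢ[ℝ] E) rfl

theorem rotIso_apply [FiniteDimensional ℝ E] (S : E →L[ℝ] E) (hS : ∀ x y : E, ⟪S x, y⟫_ℝ = -⟪x, S y⟫_ℝ)
    (τ : ℝ) (x : E) : rotIso S hS τ x = rot S τ x := rfl

/-- Translation part of the screw motion: `β τ = ∫₀^τ exp(σS) c dσ`. [folklore] -/
def trans (S : E →L[ℝ] E) (c : E) (τ : ℝ) : E := ∫ σ in (0 : ℝ)..τ, rot S σ c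

theorem trans_zero (S : E →L[ℝ] E) (c : E) : trans S c 0 = 0 := by
  simp [trans]

theorem hasDerivAt_trans (S : E →L[ℝ] E) (c : E) (τ : ℝ) : HasDerivAt (trans S c) (rot S τ c) τ := by
  have h := ((continuous_rot_apply S c).integral_hasStrictDerivAt 0 τ).hasDerivAt
  exact h

/-- `S β(τ) + c = exp(τS) c` (fundamental theorem of calculus on `σ ↦ exp(σS) c`). [folklore] -/
theorem apply_trans_add (S : E →L[ℝ] E) (c : E) (τ : ℝ) : S (trans S c τ) + c = rot S τ c := by
  have hderiv : ∀ σ ∈ uIcc (0 : ℝ) τ, HasDerivAt (fun u => rot S u c) (S (rot S σ c)) σ :=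
    fun σ _ => hasDerivAt_rot_apply S c σ
  have hint : IntervalIntegrable (fun σ => S (rot S σ c)) MeasureTheory.volume (0 : ℝ) τ :=
    (S.continuous.comp (continuous_rot_apply S c)).intervalIntegrable _ _
  have hftc := intervalIntegral.integral_eq_sub_of_hasDerivAt hderiv hint
  have hcomm : (∫ σ in (0 : ℝ)..τ, S (rot S σ c)) = S (∫ σ in (0 : ℝ)..τ, rot S σ c) :=
    S.intervalIntegral_comp_comm ((continuous_rot_apply S c).intervalIntegrable _ _)
  unfold trans
  rw [← hcomm, hftc, rot_zero, one_apply_eq_self, sub_add_cancel]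

/-- The screw motion `g_τ x = exp(τS) x + β τ` generated by the Killing field `ξ(x) = c + Sx`. [folklore] -/
def flow (S : E →L[ℝ] E) (c : E) (τ : ℝ) (x : E) : E := rot S τ x + trans S c τ

theorem flow_zero (S : E →L[ℝ] E) (c : E) (x : E) : flow S c 0 x = x := by
  simp [flow, rot_zero, trans_zero]

/-- `d/dτ g_τ x = c + S (g_τ x)`. [folklore] -/
theorem hasDerivAt_flow (S : E →L[ℝ] E) (c : E) (τ : ℝ) (x : E) :
    HasDerivAt (fun u => flow S c u x) (c + S (flow S c τ x)) τ := by
  have h := (hasDerivAt_rot_apply S x τ).add (hasDerivAt_trans S c τ)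
  have heq : S (rot S τ x) + rot S τ c = c + S (flow S c τ x) := by
    rw [flow, map_add, ← apply_trans_add S c τ]
    abel
  rw [← heq]
  exact h

end Group

/-! ### 2. The stub -/

/-- **K0 — rigid-motion kinematics** (registered stub `stub_rigidMotionKinematics` of `Lines/killing_door.lean`, VERBATIM):
an analytic field on the backward slab that is a relative equilibrium on a nonempty open space–time set has two slices
`s < t < 0` (here `s = −2`, `t = −1`) congruent by a Euclidean motion on a nonempty open set (here all of `ℝ³`). [folklore] -/
theorem stub_rigidMotionKinematics :
    ∀ (v : ℝ → EuclideanSpace ℝ (Fin 3) → EuclideanSpace ℝ (Fin 3)),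
      AnalyticOnNhd ℝ (Function.uncurry v) (Set.Iio (0 : ℝ) ×ˢ Set.univ) →
      (∃ W₁ : Set (ℝ × EuclideanSpace ℝ (Fin 3)), IsOpen W₁ ∧ W₁.Nonempty ∧ W₁ ⊆ Set.Iio (0 : ℝ) ×ˢ Set.univ ∧
          ∃ (c : EuclideanSpace ℝ (Fin 3)) (S : EuclideanSpace ℝ (Fin 3) →L[ℝ] EuclideanSpace ℝ (Fin 3)),
            (∀ x y : EuclideanSpace ℝ (Fin 3), ⟪S x, y⟫_ℝ = -⟪x, S y⟫_ℝ) ∧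
            ∀ z ∈ W₁, deriv (fun τ => v τ z.2) z.1 + fderiv ℝ (v z.1) z.2 (c + S z.2) - S (v z.1 z.2) = 0) →
      ∃ s t : ℝ, s < t ∧ t < 0 ∧
        ∃ (A : EuclideanSpace ℝ (Fin 3) ≃ₗᵢ[ℝ] EuclideanSpace ℝ (Fin 3)) (b : EuclideanSpace ℝ (Fin 3))
          (O : Set (EuclideanSpace ℝ (Fin 3))), IsOpen O ∧ O.Nonempty ∧ ∀ x ∈ O, v t x = A (v s (A.symm (x - b))) := by
  intro v han ⟨W₁, hW₁o, ⟨z₀, hz₀⟩, hW₁s, c, S, hS, hrig⟩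
  have hconn : IsPreconnected (Iio (0 : ℝ) ×ˢ (univ : Set (EuclideanSpace ℝ (Fin 3)))) :=
    isPreconnected_Iio.prod convex_univ.isPreconnected
  -- ## Step 1: the defect, written with the joint derivative, is analytic and vanishes on the slab
  obtain ⟨F, hFdef⟩ : ∃ F : ℝ × EuclideanSpace ℝ (Fin 3) → EuclideanSpace ℝ (Fin 3),
      F = fun z => fderiv ℝ (uncurry v) z (1, 0) + fderiv ℝ (uncurry v) z (0, c + S z.2) - S (uncurry v z) :=
    ⟨_, rfl⟩
  have hFan : AnalyticOnNhd ℝ F (Iio (0 : ℝ) ×ˢ univ) := by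
    intro z hz
    have hD : AnalyticAt ℝ (fderiv ℝ (uncurry v)) z := han.fderiv z hz
    have h1 : AnalyticAt ℝ (fun z => fderiv ℝ (uncurry v) z ((1 : ℝ), (0 : EuclideanSpace ℝ (Fin 3)))) z :=
      analyticAt_clm_apply_of_analyticAt hD analyticAt_const
    have hw : AnalyticAt ℝ (fun z : ℝ × EuclideanSpace ℝ (Fin 3) => ((0 : ℝ), c + S z.2)) z :=
      analyticAt_const.prod (analyticAt_const.add ((S.analyticAt _).comp analyticAt_snd))
    have h2 : AnalyticAt ℝ (fun z : ℝ × EuclideanSpace ℝ (Fin 3) => fderiv ℝ (uncurry v) z ((0 : ℝ), c + S z.2)) z :=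
      analyticAt_clm_apply_of_analyticAt hD hw
    have h3 : AnalyticAt ℝ (fun z : ℝ × EuclideanSpace ℝ (Fin 3) => S (uncurry v z)) z :=
      (S.analyticAt _).comp (han z hz)
    rw [hFdef]
    exact (h1.add h2).sub h3
  have hFeq : ∀ z ∈ Iio (0 : ℝ) ×ˢ (univ : Set (EuclideanSpace ℝ (Fin 3))),
      F z = deriv (fun τ => v τ z.2) z.1 + fderiv ℝ (v z.1) z.2 (c + S z.2) - S (v z.1 z.2) := by
    rintro ⟨t, x⟩ hz
    have hL : HasFDerivAt (uncurry v) (fderiv ℝ (uncurry v) (t, x)) (t, x) :=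
      (han _ hz).differentiableAt.hasFDerivAt
    have ht : deriv (fun τ => v τ x) t = fderiv ℝ (uncurry v) (t, x) (1, 0) := (hasDerivAt_timeLine hL).deriv
    have hx : fderiv ℝ (v t) x =
        (fderiv ℝ (uncurry v) (t, x)).comp (ContinuousLinearMap.inr ℝ ℝ (EuclideanSpace ℝ (Fin 3))) :=
      (hasFDerivAt_slice hL).fderiv
    simp only [hFdef, ht, hx, ContinuousLinearMap.comp_apply, ContinuousLinearMap.inr_apply, uncurry_apply_pair]
  have hF0 : EqOn F 0 (Iio (0 : ℝ) ×ˢ (univ : Set (EuclideanSpace ℝ (Fin 3)))) := by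
    refine hFan.eqOn_zero_of_preconnected_of_eventuallyEq_zero hconn (hW₁s hz₀) ?_
    filter_upwards [hW₁o.mem_nhds hz₀] with z hz
    show F z = 0
    rw [hFeq z (hW₁s hz)]
    exact hrig z hz
  have hpt : ∀ t : ℝ, t < 0 → ∀ x : EuclideanSpace ℝ (Fin 3),
      fderiv ℝ (uncurry v) (t, x) (1, 0) + fderiv ℝ (uncurry v) (t, x) (0, c + S x) = S (v t x) := by
    intro t ht x
    have h := hF0 (x := (t, x)) ⟨ht, mem_univ x⟩
    rw [hFdef] at h
    simpa [sub_eq_zero] using h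
  -- ## Step 2: the two slices `s = -2 < t = -1` and the motion `y ↦ A y + b`, `A = exp(S)`, `b = β 1`
  refine ⟨-2, -1, by norm_num, by norm_num, rotIso S hS 1, trans S c 1, univ, isOpen_univ, univ_nonempty, ?_⟩
  intro y _
  set x : EuclideanSpace ℝ (Fin 3) := (rotIso S hS 1).symm (y - trans S c 1) with hxdef
  -- ## Step 3: along the screw motion started at time -2, `τ ↦ v τ (g_{τ+2} x)` solves `y' = S y`
  have hγd : ∀ τ : ℝ, τ < 0 →
      HasDerivAt (fun u => v u (flow S c (u + 2) x)) (S (v τ (flow S c (τ + 2) x))) τ := by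
    intro τ hτ
    have hfl : HasDerivAt (fun u => flow S c (u + 2) x) (c + S (flow S c (τ + 2) x)) τ :=
      HasDerivAt.comp_add_const τ 2 (hasDerivAt_flow S c (τ + 2) x)
    have hL : HasFDerivAt (uncurry v) (fderiv ℝ (uncurry v) (τ, flow S c (τ + 2) x)) (τ, flow S c (τ + 2) x) :=
      (han (τ, flow S c (τ + 2) x) ⟨hτ, mem_univ _⟩).differentiableAt.hasFDerivAt
    have hcurve : HasDerivAt (fun u => (u, flow S c (u + 2) x)) (1, c + S (flow S c (τ + 2) x)) τ :=
      (hasDerivAt_id τ).prodMk hfl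
    have hcomp := hL.comp_hasDerivAt τ hcurve
    have hsplit : fderiv ℝ (uncurry v) (τ, flow S c (τ + 2) x) (1, c + S (flow S c (τ + 2) x)) =
        S (v τ (flow S c (τ + 2) x)) := by
      have hv1 : ((1 : ℝ), c + S (flow S c (τ + 2) x)) =
          ((1 : ℝ), (0 : EuclideanSpace ℝ (Fin 3))) + ((0 : ℝ), c + S (flow S c (τ + 2) x)) := by
        simp
      rw [hv1, map_add]
      exact hpt τ hτ _
    rw [hsplit] at hcomp
    exact hcomp
  have hγ'd : ∀ τ : ℝ, HasDerivAt (fun u => rot S (u + 2) (v (-2) x)) (S (rot S (τ + 2) (v (-2) x))) τ := by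
    intro τ
    exact HasDerivAt.comp_add_const τ 2 (hasDerivAt_rot_apply S (v (-2) x) (τ + 2))
  have heq : EqOn (fun u => v u (flow S c (u + 2) x)) (fun u => rot S (u + 2) (v (-2) x)) (Icc (-2 : ℝ) (-1)) := by
    refine ODE_solution_unique_of_mem_Icc_right (v := fun _ w => S w) (s := fun _ => univ) (K := ‖S‖₊)
      (fun _ _ => S.lipschitz.lipschitzOnWith) ?_ ?_ (fun _ _ => mem_univ _) ?_ ?_ (fun _ _ => mem_univ _) ?_
    · intro τ hτ
      exact (hγd τ (by linarith [hτ.2])).continuousAt.continuousWithinAt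
    · intro τ hτ
      exact (hγd τ (by linarith [hτ.2])).hasDerivWithinAt
    · intro τ _
      exact (hγ'd τ).continuousAt.continuousWithinAt
    · intro τ _
      exact (hγ'd τ).hasDerivWithinAt
    · show v (-2) (flow S c (-2 + 2) x) = rot S (-2 + 2) (v (-2) x)
      norm_num [flow_zero, rot_zero]
  have h1 := heq (x := (-1 : ℝ)) ⟨by norm_num, by norm_num⟩
  simp only at h1
  norm_num at h1
  -- h1 : v (-1) (flow S c 1 x) = rot S 1 (v (-2) x)
  have hflow : flow S c 1 x = y := by
    rw [flow, ← rotIso_apply S hS 1 x, hxdef, LinearIsometryEquiv.apply_symm_apply, sub_add_cancel]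
  rw [← hflow, rotIso_apply]
  exact h1

end Summit.NavierStokesRegularity.NavierStokesRegularity.Theorems.PoloidalWindowDoorPoloidalWindowRigidityKillingKinematics
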